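import Literature.NumberTheory.GaloisRepresentations.GalLayerSystemSES
import Literature.NumberTheory.GaloisRepresentations.IdeleCohomologyLimit
import Literature.NumberTheory.GaloisRepresentations.AbsGaloisGroup
import Literature.Algebra.Homology.DiscreteRepLayerColimitGroupCohomology
import HarnessLib

/-!
# `Extⁿ_{C_Γ}(ℤ, lim→ S) = 0` when the layers `Hⁿ(Gal(E/F), S_E)` vanish: `H¹(Γ_F, J̄) = 0`, `H³(Γ_F, J̄) = 0`,
# `H¹(Γ_F, C̄) = 0`, `H¹(Γ_F, F̄ˣ) = 0` in door-c4's `Ext` currency (Tate, C–F VII §7.3, §9 Thm 9.1, §11; Harari §13.1)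

Topic `NumberTheory/GaloisRepresentations`; namespace `Literature.NumberTheory.GaloisRepresentations`.  Sequel to
`GalLayerSystemSES.lean` (door-c5 g16: `unitsBarD`, `ideleBarD`, `classBarD`, the systems `unitsData`/`ideleData`/`classData`,
`GalLayerData.layerCohomologyIso`) and door-c4's colimit theorem in `groupCohomology` currency
(`DiscreteRepLayerColimitGroupCohomology.lean`: `ext_eq_zero_of_forall_exists_stepG_eq_zero`), with the cell's finite-layer
vanishing theorems (`IdeleCohomologyLimit.lean`: `isZero_H1_ideleRep`, `isZero_H3_ideleRep`; `IdeleClassGaloisRep.lean`: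
`isZero_H1_galoisRep`; `IdeleGaloisRep.lean`: `isZero_H1_unitsRep`).  Theorems only; NO named fact, no `sorry`, no instance,
no notation.  Route A of crux `AnticycControlAdditiveK` (item 19295): inputs of the `Ext` long exact sequence of
`0 → F̄ˣ → J̄ → C̄ → 0` in Milne's proof of ADT I 4.10 and of door-c4's `TateDualityHypotheses` at `U = Γ_F`.

Mathematics.  `Hⁿ(Γ_F, lim→_E S_E) = lim→_E Hⁿ(Gal(E/F), S_E)` (Serre I §2.2 Prop. 8; door-c4's (d) theorem with the layers
of a Galois layer system identified by `GalLayerData.layerCohomologyIso`, every open normal subgroup of `Γ_F` being `Gal(F̄/E)` for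
a layer `E`, `layerEquivOpenNormalSubgroup`).  Hence if every `Hⁿ(Gal(E/F), S_E)` vanishes, so does `Hⁿ(Γ_F, lim→ S_E)`
(as `Extⁿ_{C_Γ}(ℤ, ·)`).  Instances: `H¹(Γ_F, J̄) = 0` and `H³(Γ_F, J̄) = 0` (Tate VII §7.3 Cor. 7.4 / Harari Cor. 13.2 at every
layer), `H¹(Γ_F, C̄) = 0` (Tate VII §9 Thm. 9.1 (2)), `H¹(Γ_F, F̄ˣ) = 0` (Hilbert 90 at every layer).

## What is formalised (`F : Type` a number field, `Γ = absoluteGaloisGroup F`)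

* `GalLayer.exists_openNormalSubgroup_eq` (every open normal `U ≤ Γ_F` is `U_E`).
* **`GalLayerData.ext_triv_eq_zero_of_isZero_layers`**: `(∀ E, Hⁿ(Gal(E/F), D.obj E) = 0) → Extⁿ_{C_Γ}(ℤ, lim D) = 0`;
  `GalLayerData.layer_eq_zero_of_isZero`.
* **`ideleBarD_ext_triv_one_eq_zero`** (`H¹(Γ_F, J̄) = 0`), **`ideleBarD_ext_triv_three_eq_zero`** (`H³(Γ_F, J̄) = 0`),
  **`classBarD_ext_triv_one_eq_zero`** (`H¹(Γ_F, C̄) = 0`), **`unitsBarD_ext_triv_one_eq_zero`** (`H¹(Γ_F, lim→ Eˣ) = 0`).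

## References
* J. W. S. Cassels, A. Fröhlich (eds.), *Algebraic Number Theory* (1967), Ch. VII (J. Tate) §7.3 (Cor. 7.4), §9 Thm. 9.1,
  §11.1. [CasselsFrohlichANT1967]
* D. Harari, *Galois Cohomology and Class Field Theory* (2020), §13.1 (Cor. 13.2). [Harari2020]
* J.-P. Serre, *Galois Cohomology*, Springer (1997), I §2.2 Proposition 8. [SerreGaloisCohomology1997]
-/

noncomputable section

open CategoryTheory CategoryTheory.Limits CategoryTheory.Abelian NumberField groupCohomology
open Field (absoluteGaloisGroup)
open Literature.Algebra.Homology
open Literature.NumberTheory.Automorphic Literature.NumberTheory.Automorphic.IdeleClassGroup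
open Literature.NumberTheory.NumberFields
open scoped Classical

namespace Literature.NumberTheory.GaloisRepresentations

open IdeleClassBar

variable (F : Type) [Field F] [NumberField F]

/-- **Every open normal subgroup of `Γ_F` is `U_E = Gal(F̄/E)` for a (unique) finite Galois layer `E`** (the dictionary
`layerEquivOpenNormalSubgroup`). [cite: SerreGaloisCohomology1997, I §2.2] -/
theorem IdeleClassBar.GalLayer.exists_openNormalSubgroup_eq (U : OpenNormalSubgroup (absoluteGaloisGroup F)) :
    ∃ E : GalLayer F, E.openNormalSubgroup = U :=
  ⟨GalLayer.ofOpenNormalSubgroup U, GalLayer.openNormalSubgroup_ofOpenNormalSubgroup U⟩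

namespace GalLayerData

variable {F} (D : GalLayerData F)

/-- If `Hⁿ(Gal(E/F), D.obj E) = 0` then the layer `Hⁿ(Γ_F ⧸ U_E, (lim D)^{U_E})` of door-c4's system vanishes.
[cite: SerreGaloisCohomology1997, I §2.2 Proposition 8] -/
theorem layer_eq_zero_of_isZero (n : ℕ) (E : GalLayer F) (h : IsZero (groupCohomology (D.obj E) n))
    (c : groupCohomology (D.layerRep E) n) : c = 0 := by
  haveI := ModuleCat.subsingleton_of_isZero h
  refine (D.layerCohomologyIso E n).toLinearEquiv.injective ?_
  rw [map_zero]
  exact Subsingleton.elim _ _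

/-- **Vanishing in the limit: if `Hⁿ(Gal(E/F), D.obj E) = 0` for every layer `E`, then `Extⁿ_{C_Γ}(ℤ, lim→ D) = 0`**
(door-c4's vanishing transfer `ext_eq_zero_of_forall_exists_stepG_eq_zero`, every open normal subgroup being a `U_E`).
[cite: SerreGaloisCohomology1997, I §2.2 Proposition 8] -/
theorem ext_triv_eq_zero_of_isZero_layers (n : ℕ) (h : ∀ E : GalLayer F, IsZero (groupCohomology (D.obj E) n))
    (x : Ext (DiscreteRep.triv (Γ := absoluteGaloisGroup F) ℤ) D.toSystem.toD n) : x = 0 := by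
  refine DiscreteRep.LayerColimit.ext_eq_zero_of_forall_exists_stepG_eq_zero n D.toSystem.toD (fun U c => ?_) x
  obtain ⟨E, rfl⟩ := GalLayer.exists_openNormalSubgroup_eq F U
  refine ⟨E.openNormalSubgroup, le_rfl, ?_⟩
  rw [D.layer_eq_zero_of_isZero n E (h E) c, map_zero]

end GalLayerData

/-- **`H¹(Γ_F, J̄) = 0`** (`Ext¹_{C_Γ}(ℤ, J̄) = 0`): `H¹(Gal(E/F), J_E) = 0` at every layer (Tate VII §7.3 Cor. 7.4 (a); Harari
Cor. 13.2), tree `isZero_H1_ideleRep`. [cite: CasselsFrohlichANT1967, Ch. VII §7.3 Cor. 7.4][cite: Harari2020, §13.1 Cor. 13.2] -/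
theorem ideleBarD_ext_triv_one_eq_zero
    (x : Ext (DiscreteRep.triv (Γ := absoluteGaloisGroup F) ℤ) (ideleBarD F) 1) : x = 0 :=
  (ideleData F).ext_triv_eq_zero_of_isZero_layers 1 (fun E => by
    haveI := E.numberField
    haveI := E.isGalois
    exact IdeleCohomology.isZero_H1_ideleRep (F := F) (E := E.1)) x

/-- **`H³(Γ_F, J̄) = 0`** (`Ext³_{C_Γ}(ℤ, J̄) = 0`): `H³(Gal(E/F), J_E) = 0` at every layer (Harari Cor. 13.2, second half), tree
`isZero_H3_ideleRep`. [cite: Harari2020, §13.1 Cor. 13.2][cite: CasselsFrohlichANT1967, Ch. VII §7.3] -/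
theorem ideleBarD_ext_triv_three_eq_zero
    (x : Ext (DiscreteRep.triv (Γ := absoluteGaloisGroup F) ℤ) (ideleBarD F) 3) : x = 0 :=
  (ideleData F).ext_triv_eq_zero_of_isZero_layers 3 (fun E => by
    haveI := E.numberField
    haveI := E.isGalois
    exact IdeleCohomology.isZero_H3_ideleRep (F := F) (E := E.1)) x

/-- **`H¹(Γ_F, C̄) = 0`** (`Ext¹_{C_Γ}(ℤ, C̄) = 0`, for g15's `classBarD F`): axiom I `H¹(Gal(E/F), C_E) = 0` at every layer (Tate
VII §9 Thm. 9.1 (2)), tree `isZero_H1_galoisRep`.  (The version at every OPEN subgroup `U ≤ Γ_F`, needed for door-c4's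
`TateDualityHypotheses`, is the relative-layer generalisation, door-c6's lane.) [cite: CasselsFrohlichANT1967, Ch. VII §9 Thm. 9.1] -/
theorem classBarD_ext_triv_one_eq_zero
    (x : Ext (DiscreteRep.triv (Γ := absoluteGaloisGroup F) ℤ) (classBarD F) 1) : x = 0 :=
  (classData F).ext_triv_eq_zero_of_isZero_layers 1 (fun E => by
    haveI := E.numberField
    haveI := E.isGalois
    exact IdeleClassGroup.isZero_H1_galoisRep (F := F) (E := E.1)) x

/-- **`H¹(Γ_F, lim→ Eˣ) = 0`** (`Ext¹_{C_Γ}(ℤ, lim→ Eˣ) = 0`; with `unitsBarIso` this is Hilbert 90 for `F̄ˣ` in `Ext` form):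
`H¹(Gal(E/F), Eˣ) = 0` at every layer (Hilbert 90, Mathlib; tree `isZero_H1_unitsRep`).
[cite: CasselsFrohlichANT1967, Ch. VII §11.1] -/
theorem unitsBarD_ext_triv_one_eq_zero
    (x : Ext (DiscreteRep.triv (Γ := absoluteGaloisGroup F) ℤ) (unitsBarD F) 1) : x = 0 :=
  (unitsData F).ext_triv_eq_zero_of_isZero_layers 1 (fun E => by
    haveI := E.numberField
    haveI := E.finiteDimensional
    exact IdeleClassGroup.isZero_H1_unitsRep (F := F) (E := E.1)) x

end Literature.NumberTheory.GaloisRepresentations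

end
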